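import Summits.BirchSwinnertonDyer.Rank1Residual.Additive.SignedTwistMinusClassLayers
import Summits.BirchSwinnertonDyer.Rank1Residual.Additive.SignedTwistLocalEulerBound
import Summits.BirchSwinnertonDyer.Rank1Residual.Additive.SignedConditionToLocalKummer
import Summits.BirchSwinnertonDyer.Rank1Residual.Additive.QuadraticTwistTowerNoPTorsion
import Summits.BirchSwinnertonDyer.Rank1Residual.Additive.KobayashiSignedGenerationTower
import Summits.BirchSwinnertonDyer.Rank1Residual.Additive.LocalTrivialityUpTower
import Summits.BirchSwinnertonDyer.Rank1Residual.Additive.LocalKummerOrder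
import Summits.BirchSwinnertonDyer.Rank1Residual.GaloisImage.LocalEulerPoincareCharacteristicHolds
import Summits.BirchSwinnertonDyer.Rank1Residual.X11b.KummerLocalIndex
import Literature.NumberTheory.EllipticCurves.PointDivisibilityProofs
import Literature.NumberTheory.EllipticCurves.BSDRankZeroDensity
import HarnessLib

/-!
# THE MORDELL–WEIL LINE MEETS `A₀ = Sel^{loc,∞}(W/ℚ)` IN AT MOST `p^ν` CLASSES: a level-`m` Kummer
# class `κ_m(a·P)` lies in `A₀` only if `p^{m−ν} ∣ a` (cell `b2b-bsdres`, CLASS-CLOSURE lane, class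
# O10 — x1b GEN 43, class lead; file 112 of the series: the LOCAL–GLOBAL half of "`A₀` is finite in
# rank one", i.e. of the torsion-ness of `X^{−,str}(W/ℚ_∞)` with `f(0) ≠ 0` via file 110)

HONEST FRAMING (cell `b2b-bsdres`, run/shared/lean/b2b/bsd-rank1-residual/, verbatim in every
file): the goal of the cell is to DELETE the COMBINATION-SHAPED residual classes of the
Birch–Swinnerton-Dyer formula for ALL analytic-rank `≤ 1` elliptic curves over `ℚ` — "full BSD
formula for every rank `≤ 1` curve in class `C`" assembled STRICTLY from published theorems — so
that the rank-`≤ 1` remainder becomes exactly the CONSTRUCTION-SHAPED classes, which are TYPED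
(missing-input `Prop`s), NOT attempted. This is not "finishing BSD". CLASS-CLOSURE lane: prove
what is provable now; shrink each hard class to its core with data; no claim beyond stated classes;
research routes on CONSTRUCTION-SHAPED X12 / O10; census / instrument output = EVIDENCE / conjecture
items, NEVER a Literature fact; `RESIDUAL-MAP.md` marks change only by signed lines. THIS FILE:
TOOL THEOREMS ONLY — no definition, no named Literature fact, no Summits-side fact `def … : Prop`,
no `sorry`, axioms standard; Tate's local Euler characteristic is the tree's THEOREM
`localEulerPoincareCharacteristic_holds` (n1011 T-EPC), so nothing fact-shaped is assumed; nothing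
is booked; no label / mark / count / sub-cell moves; (C1_η), (C2_η-GZ), (C3_η) stay typed as filed
(cc-typer-6's pen); O10 stays OPEN / CONSTRUCTION-SHAPED; nothing about `BSD(W, p)` of any pair is
claimed.

## What

File 110 reduced the `Λ`-torsion of `X^{−,str}(W/ℚ_∞)` and `f(0) ≠ 0` to the finiteness of
`A₀ = Sel^{loc,∞}(W/ℚ)` (classes over `ℚ` whose restriction to `ℚ_∞` is Selmer and strict-minus at
`p`). For the `p*`-twist `W` of a globally minimal good `a_p = 0` curve `V` (`p` odd, `W`'s equation
`p`-integral, `κ` the cyclotomic `ℤ_p`-extension, model `ℚ_[p]`) this file proves the LOCAL–GLOBAL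
half of that finiteness, with NO hypothesis besides the objects:

* §1 (groups) `inf_eq_bot_of_sup_eq_top_of_card_mul`: `H ⊔ K = ⊤`, `#H · #K = #G` ⟹ `H ⊓ K = ⊥`.
* §2 **`res_padic_eq_zero_of_levelToLayerZero_mem_localPreimage`**: if a level-`p^m` class `c` over
  `ℚ` maps into `A₀` (`h₀ Ψ_m c ∈ Sel^{loc,∞}`) AND its restriction to `ℚ_p` is a local Kummer class
  (`res_p c ∈ 𝓚_m = κ(W(ℚ_p))`), then **`res_p c = 0`**. Proof: by file 86 + file 106 `res_p c` lies
  on the minus line `Σ_m` (B3 in level-`m` shape, file 98: `Σ_m ⊔ 𝓚_m = H¹(ℚ_p, W[p^m])`,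
  `#Σ_m = p^m`, `#H¹ = p^{2m}`), `#𝓚_m = p^m` (`SignedTwist.natCard_range_localKummerMap`), so
  `Σ_m ⊓ 𝓚_m = 0` (§1).
* §3 **`pow_dvd_of_zsmul_kummerMapTorsion_mem_localPreimage`**: for `P ∈ W(ℚ)` of exact level `ν`
  in `W(ℚ_p)` (`p^ν Q = P`, no `p^{ν+1} Q' = P`), `ν ≤ m`, and `a ∈ ℤ`: if the multiple
  `a·[κ_m(P)]` of the image of the Kummer class `κ_m(P) ∈ H¹(ℚ, W[p^m])` lies in `A₀`, then
  **`p^{m−ν} ∣ a`** (`res_p(a·κ_m(P)) = a·κ_p(P_p)`, of order `p^{m−ν}`,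
  `LocalKummerOrder.addOrderOf_localKummerMap_eq`; X11b's `res_kummerMapTorsion_eq_localKummerMap`),
  **hence `p^ν` kills it** (`pow_smul_zsmul_kummerMapTorsion_eq_zero_of_mem_localPreimage`:
  `p^ν a = p^m b` and `p^m` kills `H¹(ℚ, W[p^m])`). In particular (`a = 1`, `m ≥ ν + 1`)
  `[κ_m(P)] ∉ A₀`: the Mordell–Weil line `W(ℚ) ⊗ ℚ_p/ℤ_p` meets `A₀` only in its `p^ν`-torsion. The
  `_signedPrime` variant takes the consumers' binders (`hdiv` from the tree).

What remains for "`A₀` finite" (hence, by file 110, `X^{−,str}(W/ℚ_∞)` torsion with `f(0) ≠ 0` in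
rank one): the GLOBAL-DUALITY half — every class of `A₀` has a bounded multiple on the Mordell–Weil
line modulo `Ш[p^∞]` (the relaxed-versus-Selmer finiteness, JSW17 Prop. 3.3.2 shape, from the named
fact `poitouTate_selmerStructure_duality_real ℚ` and `#Sel_str < ∞`); NOT proved here. NOT claimed:
(C1_η), (C2_η-GZ), (C3_η) as typed; any `BSD(W, p)`.

References: [Kobayashi2003] Def. 2.1 (p. 5), Thm. 6.2 (p. 11), Prop. 8.7 (p. 16), Lemma 8.17
(p. 19), §9; [GreenbergLNM1716] §2 (pp. 62–63), §3 (pp. 85–90); [MilneADT2006] I Thm. 2.8;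
[SilvermanAEC2009] VIII.§2, X.§4; [JetchevSkinnerWan2017] Prop. 3.3.2 (the missing half, shape only).
-/

noncomputable section

open scoped Classical

open CategoryTheory Field Function NumberField IsDedekindDomain WeierstrassCurve
open Literature.NumberTheory.EllipticCurves
open Literature.NumberTheory.GaloisRepresentations
open Literature.NumberTheory.GaloisCohomology
open Literature.NumberTheory.EllipticCurves.Kobayashi2003
open Summit.BirchSwinnertonDyer.Rank1Residual.X11b.Levels
open Summit.BirchSwinnertonDyer.Rank1Residual.X11b
open scoped ContRepresentation

namespace Summit.BirchSwinnertonDyer.Rank1Residual.Additive.LevelBridge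

/-! ## §1 Two subgroups generating a finite abelian group with `#H · #K = #G` meet trivially -/

section Groups

variable {G : Type*} [AddCommGroup G] [Finite G] {H K : AddSubgroup G}

/-- **`H ⊔ K = ⊤` and `#H · #K = #G` ⟹ `H ⊓ K = ⊥`** (finite abelian group): `[G : K] = [H ⊔ K : K]
= [H : H ⊓ K]` (second isomorphism theorem as an index identity, `relIndex_sup_right`), and
`#K · [G : K] = #G = #H · #K` gives `[H : H ⊓ K] = #H`, i.e. `#(H ⊓ K) = 1`. [folklore] -/
theorem inf_eq_bot_of_sup_eq_top_of_card_mul (hsup : H ⊔ K = ⊤) (hcard : Nat.card H * Nat.card K = Nat.card G) :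
    H ⊓ K = ⊥ := by
  have hKpos : 0 < Nat.card K := Nat.card_pos
  have hHpos : 0 < Nat.card H := Nat.card_pos
  -- `[G : K] = K.relIndex H = [H : H ⊓ K]`
  have h1 : K.relIndex H = K.index := by
    rw [← AddSubgroup.relIndex_sup_right, hsup, AddSubgroup.relIndex_top_right]
  have h2 : Nat.card K * K.index = Nat.card G := AddSubgroup.card_mul_index K
  have hidx : K.index = Nat.card H := by
    rw [← hcard, mul_comm (Nat.card H)] at h2
    exact Nat.eq_of_mul_eq_mul_left hKpos h2
  -- inside `H`: `#(K ∩ H) · [H : K ∩ H] = #H`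
  have h3 : Nat.card (K.addSubgroupOf H) * (K.addSubgroupOf H).index = Nat.card H :=
    AddSubgroup.card_mul_index _
  have hrel : (K.addSubgroupOf H).index = K.relIndex H := rfl
  rw [hrel, h1, hidx] at h3
  have hone : Nat.card (K.addSubgroupOf H) = 1 := by
    have h4 : Nat.card (K.addSubgroupOf H) * Nat.card H = 1 * Nat.card H := by rw [h3, one_mul]
    exact Nat.eq_of_mul_eq_mul_right hHpos h4
  have hbot : K.addSubgroupOf H = ⊥ := AddSubgroup.eq_bot_of_card_eq _ hone
  rw [AddSubgroup.addSubgroupOf_eq_bot] at hbot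
  exact disjoint_iff.mp hbot.symm

end Groups

/-! ## §2 A class of `A₀` whose restriction to `ℚ_p` is a Kummer class restricts to ZERO -/

section Twist

variable (W : WeierstrassCurve ℚ) [W.IsElliptic] {p : ℕ} [hp : Fact p.Prime] (κ : ZpExtension ℚ p)
  {m : ℕ} [hint : (W.baseChange ℚ_[p]).IsIntegral ℤ_[p]]

/-- **A level-`p^m` class over `ℚ` that maps into `A₀ = Sel^{loc,∞}(W/ℚ)` and restricts to a local
Kummer class at `ℚ_p` restricts to ZERO at `ℚ_p`**, for the `(−1)^{p/2}p`-twist `W` of a globally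
minimal `V/ℚ` good at the odd prime `p` with `a_p(V) = 0` (`W`'s equation `p`-integral, `κ`
cyclotomic, model `ℚ_[p]`). By file 86 (`exists_kummer_cocycle_of_mem_localKummerOverOfEmb_iSup_
strictSigned`) and file 106 (`mem_closure_minus_of_strictSigned_kummer`) `res_p c` lies on the minus
line `Σ_m` of some layer `n ≥ 2m − 1`; B3 in level-`m` shape (file 98,
`closure_minus_sup_range_localKummerMap_eq_top_of_localEuler`, Tate's Euler characteristic being the
tree's theorem `localEulerPoincareCharacteristic_holds`): `Σ_m ⊔ 𝓚_m = H¹(ℚ_p, W[p^m])`,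
`#Σ_m = p^m`, `#H¹ = p^{2m}`; `#𝓚_m = p^m` (`natCard_range_localKummerMap`); hence `Σ_m ⊓ 𝓚_m = 0`
(§1). (htors)/(hB)-type inputs are file 55's theorems for the twist. Nothing booked.
[cite: Kobayashi2003, Def. 2.1 (p. 5), Thm. 6.2 (p. 11), Prop. 8.7 (p. 16), Lemma 8.17 (p. 19)]
[cite: GreenbergLNM1716, §3 pp. 85–90] [cite: MilneADT2006, Ch. I, Thm. 2.8 (p. 31)] -/
theorem res_padic_eq_zero_of_levelToLayerZero_mem_localPreimage
    (hp2 : p ≠ 2) (hκ : κ.IsCyclotomic) (Cv : VariableChange ℚ) (V : WeierstrassCurve ℚ)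
    [V.IsElliptic] [V.IsGloballyMinimal] (hCV : Cv • W.quadraticTwist ((-1) ^ (p / 2) * p) = V)
    (hgood : V.HasGoodReductionAtPrime p) (hap : V.frobeniusTrace p = 0)
    (c : galoisCohomology (W.torsionGaloisModule ((p ^ m : ℕ) : ℤ)) 1)
    (hc : resH1Hom (Literature.NumberTheory.EllipticCurves.subgroupIncl (κ.layerSubgroup 0))
        (AddMonoidHom.id (geomPrimaryTorsion W p))
        (fun _ _ ↦ rfl) (galoisCohomology.map (primaryInclusion W p m) 1 c) ∈
        (W.selmerInfty κ ⊓ ⨅ σ : absoluteGaloisGroup ℚ,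
            (localKummerOverOfEmb W p κ.kerSubgroup (closureEmb (K := ℚ) ℚ_[p])
              (⨆ n, strictSignedLocalPoints κ ℚ_[p] W (-1) n)).comap
              (W.conjH1 p κ.kerSubgroup σ)).comap (W.layerToInfty κ 0))
    (hK : galoisCohomology.res (W.torsionGaloisModule ((p ^ m : ℕ) : ℤ)) ℚ_[p] 1 c ∈
      (W.localKummerMap ℚ_[p]
        (show (((p ^ m : ℕ) : ℤ)) ≠ 0 by exact_mod_cast pow_ne_zero m hp.out.ne_zero)).range) :
    galoisCohomology.res (W.torsionGaloisModule ((p ^ m : ℕ) : ℤ)) ℚ_[p] 1 c = 0 := by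
  haveI : NeZero (p ^ m) := ⟨pow_ne_zero m hp.out.ne_zero⟩
  have hn0 : (((p ^ m : ℕ) : ℤ)) ≠ 0 := by exact_mod_cast pow_ne_zero m hp.out.ne_zero
  -- Tate's local Euler characteristic at `ℚ_[p]`, a theorem of the tree
  have hEPp : haveI : IsNonarchimedeanLocalField ℚ_[p] := Padic.isNonarchimedeanLocalField_holds p
      localEulerPoincareCharacteristic ℚ_[p] := by
    haveI : IsNonarchimedeanLocalField ℚ_[p] := Padic.isNonarchimedeanLocalField_holds p
    exact localEulerPoincareCharacteristic_holds ℚ_[p]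
  -- (htors) for the twist (file 55), at `ℚ_[p]`
  obtain ⟨M₀, hΔ, hA, hVM₀⟩ := exists_goodSupersingularPadicModel hp2 V hgood hap
  have hsq := sq_ne_neg_one_pow_mul_prime hp.out (p / 2)
  have htorsE := eq_zero_of_prime_pow_smul_eq_zero_localFixedPointsOfEmb_kerSubgroup_of_quadraticTwist κ
    (closureEmb (K := ℚ) ℚ_[p]) hp2 W hsq Cv hCV M₀ hΔ hA hVM₀
  have htorsX := eq_zero_of_prime_smul_eq_zero_padic_of_quadraticTwist_signedPrime hp2 W Cv hCV M₀ hΔ hA hVM₀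
  have htorsL : ∀ n', ∀ Q ∈ localLayerPointsOfEmb κ (closureEmb (K := ℚ) ℚ_[p]) W n', p • Q = 0 → Q = 0 :=
    fun n' Q hQ hpQ ↦ htorsE Q
      (localFixedPointsOfEmb_antitone (closureEmb (K := ℚ) ℚ_[p]) W (κ.kerSubgroup_le_layerSubgroup n') hQ)
      ⟨1, by rwa [pow_one]⟩
  have htorsInf : ∀ Q ∈ localFixedPointsOfEmb (closureEmb (K := ℚ) ℚ_[p]) W κ.kerSubgroup,
      ∀ j : ℕ, p ^ j • Q = 0 → Q = 0 := fun Q hQ j hj ↦ htorsE Q hQ ⟨j, hj⟩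
  -- the good supersingular `ℤ_p`-model in the Honda–Kobayashi binders, and `ℚ(μ_p)`
  obtain ⟨M, hM1, hM2, htr, hVM⟩ := exists_padicModel_tr_eq_zero V hgood hap
  haveI := hM1
  haveI := hM2
  haveI : NeZero p := ⟨hp.out.ne_zero⟩
  haveI hcycF : IsCyclotomicExtension {p} ℚ (CyclotomicField p ℚ) := by
    have h : (CyclotomicField.algebra p ℚ : Algebra ℚ (CyclotomicField p ℚ)) = DivisionRing.toRatAlgebra :=
      Subsingleton.elim _ _
    exact h ▸ CyclotomicField.isCyclotomicExtension p ℚ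
  -- the minus line of layer `n'` at level `p^m`
  set Sg : ℕ → AddSubgroup (galoisCohomology
      (GaloisRep.restrictField ℚ_[p] (W.torsionGaloisModule ((p ^ m : ℕ) : ℤ))) 1) := fun n' ↦
    AddSubgroup.closure {ξ | ∃ x ∈ signedLocalPointsOfEmb κ (closureEmb (K := ℚ) ℚ_[p]) W (-1) n' ⊓
          (localTraceOfEmb κ (closureEmb (K := ℚ) ℚ_[p]) W 0 n').ker,
        ∃ R : localPoints W ℚ_[p], ((p ^ m : ℕ) : ℤ) • R = x ∧
        ∃ φ : contOneCocycles (DiscreteGaloisModule.toTopRep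
            (GaloisRep.restrictField ℚ_[p] (W.torsionGaloisModule ((p ^ m : ℕ) : ℤ)))),
          oneCocycleClass _ φ = ξ ∧
          ∀ u ∈ localLayerSubgroupOfEmb κ (closureEmb (K := ℚ) ℚ_[p]) n',
            pointsMap W ℚ_[p] ((φ.1 u : geomTorsion W ((p ^ m : ℕ) : ℤ)) : geomPoints W) = u • R - R}
    with hSg
  -- the signed component of `hc` at `σ = 1`, in `h_0`-form (as file 107)
  have hc1 : resH1Hom (Literature.NumberTheory.EllipticCurves.subgroupIncl κ.kerSubgroup)
      (AddMonoidHom.id (geomPrimaryTorsion W p))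
      (fun _ _ ↦ rfl) (galoisCohomology.map (primaryInclusion W p m) 1 c) ∈
      localKummerOverOfEmb W p κ.kerSubgroup (closureEmb (K := ℚ) ℚ_[p])
        (⨆ n, strictSignedLocalPointsOfEmb κ (closureEmb (K := ℚ) ℚ_[p]) W (-1) n) := by
    have h := (AddSubgroup.mem_iInf.mp (AddSubgroup.mem_inf.mp (AddSubgroup.mem_comap.mp hc)).2) 1
    rw [AddSubgroup.mem_comap, W.conjH1_one_holds p κ.kerSubgroup, AddMonoidHom.id_apply,
      layerToInfty_levelToLayerZero_eq] at h
    exact h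
  -- file 86 + file 106: `res_p c ∈ Σ` at some layer, hence at the layer `n = max (2m) n₁`
  obtain ⟨n₁, x, hx, R, hR, φ, hφ, hφu⟩ :=
    exists_kummer_cocycle_of_mem_localKummerOverOfEmb_iSup_strictSigned W p m ℚ_[p] κ htorsL htorsInf c hc1
  set n := max (2 * m) n₁ with hn
  have hmem : galoisCohomology.res (W.torsionGaloisModule ((p ^ m : ℕ) : ℤ)) ℚ_[p] 1 c ∈ Sg n :=
    closure_minus_mono W κ ℚ_[p] (le_max_right (2 * m) n₁)
      (mem_closure_minus_of_strictSigned_kummer W κ ℚ_[p] n₁ htorsInf hx hR φ hφ.symm hφu)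
  -- B3 in level-`m` shape at the layer `n` (file 98) and `#𝓚 = p^m`
  have hB3 : Sg n ⊔ (W.localKummerMap ℚ_[p] hn0).range = ⊤ ∧ Nat.card (Sg n) = p ^ m ∧
      Nat.card (galoisCohomology
          (GaloisRep.restrictField ℚ_[p] (W.torsionGaloisModule ((p ^ m : ℕ) : ℤ))) 1) = p ^ (2 * m) ∧
      ∃ s ∈ Sg n, addOrderOf s = p ^ m :=
    SignedTwist.closure_minus_sup_range_localKummerMap_eq_top_of_localEuler W κ (CyclotomicField p ℚ)
      hp2 hκ Cv hCV M htr hVM (show 2 * m ≤ n + 1 by omega) hEPp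
  obtain ⟨hsup, hS, hH, -⟩ := hB3
  have hKcard := (SignedTwist.natCard_range_localKummerMap W htorsX m).1
  haveI hfin : Finite (galoisCohomology
      (GaloisRep.restrictField ℚ_[p] (W.torsionGaloisModule ((p ^ m : ℕ) : ℤ))) 1) :=
    SignedTwist.finite_galoisCohomology_torsion_padic W hn0
  -- `Σ ⊓ 𝓚 = ⊥`
  have hbot : Sg n ⊓ (W.localKummerMap ℚ_[p] hn0).range = ⊥ :=
    inf_eq_bot_of_sup_eq_top_of_card_mul hsup (by rw [hS, hKcard, hH, ← pow_add, ← two_mul])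
  have hx0 : galoisCohomology.res (W.torsionGaloisModule ((p ^ m : ℕ) : ℤ)) ℚ_[p] 1 c ∈
      Sg n ⊓ (W.localKummerMap ℚ_[p] hn0).range := AddSubgroup.mem_inf.mpr ⟨hmem, hK⟩
  rw [hbot] at hx0
  exact (AddSubgroup.mem_bot).mp hx0

/-! ## §3 The Mordell–Weil line: `a·[κ_m(P)] ∈ A₀` forces `p^{m−ν} ∣ a`, hence `p^ν` kills it -/

/-- **`a · Φ_m(κ_m(P)) ∈ A₀ ⟹ p^{m−ν} ∣ a`** — the same bound for the multiples of the CLASS of `P`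
(all scalars act on cohomology groups, none on points): `res_p(a·κ_m(P)) = a·κ_p(P_p)` is a Kummer
class, §2 kills it, and `ord κ_p(P_p) = p^{m−ν}`. [cite: Kobayashi2003, Thm. 6.2 (p. 11), §9]
[cite: GreenbergLNM1716, §2 (pp. 62–63), §3 pp. 85–90] [cite: SilvermanAEC2009, X.§4 diagram (**)] -/
theorem pow_dvd_of_zsmul_kummerMapTorsion_mem_localPreimage
    (hp2 : p ≠ 2) (hκ : κ.IsCyclotomic) (Cv : VariableChange ℚ) (V : WeierstrassCurve ℚ)
    [V.IsElliptic] [V.IsGloballyMinimal] (hCV : Cv • W.quadraticTwist ((-1) ^ (p / 2) * p) = V)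
    (hgood : V.HasGoodReductionAtPrime p) (hap : V.frobeniusTrace p = 0)
    (hdiv : ∀ P : geomPoints W, ∃ Q : geomPoints W, ((p ^ m : ℕ) : ℤ) • Q = P)
    {ν : ℕ} (hνm : ν ≤ m) (P : W.toAffine.Point) {Q : (W.baseChange ℚ_[p]).toAffine.Point}
    (hPQ : p ^ ν • Q = Affine.Point.baseChange (W' := W) ℚ ℚ_[p] P)
    (hexact : ∀ Q' : (W.baseChange ℚ_[p]).toAffine.Point,
      p ^ (ν + 1) • Q' ≠ Affine.Point.baseChange (W' := W) ℚ ℚ_[p] P)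
    (a : ℤ)
    (ha : a • resH1Hom (Literature.NumberTheory.EllipticCurves.subgroupIncl (κ.layerSubgroup 0))
        (AddMonoidHom.id (geomPrimaryTorsion W p)) (fun _ _ ↦ rfl)
        (galoisCohomology.map (primaryInclusion W p m) 1
          (kummerMapTorsion W ((p ^ m : ℕ) : ℤ) hdiv P)) ∈
        (W.selmerInfty κ ⊓ ⨅ σ : absoluteGaloisGroup ℚ,
            (localKummerOverOfEmb W p κ.kerSubgroup (closureEmb (K := ℚ) ℚ_[p])
              (⨆ n, strictSignedLocalPoints κ ℚ_[p] W (-1) n)).comap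
              (W.conjH1 p κ.kerSubgroup σ)).comap (W.layerToInfty κ 0)) :
    ((p ^ (m - ν) : ℕ) : ℤ) ∣ a := by
  have hn0 : (((p ^ m : ℕ) : ℤ)) ≠ 0 := by exact_mod_cast pow_ne_zero m hp.out.ne_zero
  obtain ⟨M₀, hΔ, hA, hVM₀⟩ := exists_goodSupersingularPadicModel hp2 V hgood hap
  have htorsX := eq_zero_of_prime_smul_eq_zero_padic_of_quadraticTwist_signedPrime hp2 W Cv hCV M₀ hΔ hA hVM₀
  -- `a · Φ_m(G(κ_m P)) = Φ_m(G(a · κ_m P))` (term-mode additivity; no rewriting under `Φ_m`)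
  set G := galoisCohomology.map (primaryInclusion W p m) 1 with hG
  set Φ := resH1Hom (Literature.NumberTheory.EllipticCurves.subgroupIncl (κ.layerSubgroup 0))
    (AddMonoidHom.id (geomPrimaryTorsion W p)) (fun _ _ ↦ rfl) with hΦ
  set c : galoisCohomology (W.torsionGaloisModule ((p ^ m : ℕ) : ℤ)) 1 :=
    kummerMapTorsion W ((p ^ m : ℕ) : ℤ) hdiv P with hc
  have e : Φ (G (a • c)) = a • Φ (G c) := (congrArg Φ (map_zsmul G a c)).trans (map_zsmul Φ a (G c))
  rw [← e] at ha
  -- `res_p (a·κ_m(P)) = a · κ_p(P_p)` is a Kummer class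
  have hres : galoisCohomology.res (W.torsionGaloisModule ((p ^ m : ℕ) : ℤ)) ℚ_[p] 1 (a • c) =
      a • W.localKummerMap ℚ_[p] hn0 (Affine.Point.baseChange (W' := W) ℚ ℚ_[p] P) := by
    rw [map_zsmul, hc, KummerIndex.res_kummerMapTorsion_eq_localKummerMap W ℚ_[p] hn0 hdiv P]
    rfl
  have hK : galoisCohomology.res (W.torsionGaloisModule ((p ^ m : ℕ) : ℤ)) ℚ_[p] 1 (a • c) ∈
      (W.localKummerMap ℚ_[p] hn0).range := by
    rw [hres]
    exact AddSubgroup.zsmul_mem _ (AddMonoidHom.mem_range.mpr ⟨_, rfl⟩) a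
  have h0 := res_padic_eq_zero_of_levelToLayerZero_mem_localPreimage W κ hp2 hκ Cv V hCV hgood hap
    _ ha hK
  rw [hres] at h0
  have hord := LocalKummerOrder.addOrderOf_localKummerMap_eq W ℚ_[p] (m := m) hνm htorsX hPQ hexact
  have hdvd := (addOrderOf_dvd_iff_zsmul_eq_zero).mpr h0
  rw [hord] at hdvd
  exact_mod_cast hdvd

/-- **… hence `p^ν · (a · Φ_m(κ_m(P))) = 0`**: `a = p^{m−ν} b`, so `p^ν a = p^m b`, and `p^m` kills
`H¹(ℚ, W[p^m])` (`zsmul_galH1Torsion_eq_zero`). So EVERY Mordell–Weil multiple found in `A₀` is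
killed by `p^ν` — the form consumed by the rank-one assembly (file 114). [cite: Kobayashi2003, Thm. 6.2 (p. 11), §9]
[cite: SilvermanAEC2009, VIII.§2, X.§4] -/
theorem pow_smul_zsmul_kummerMapTorsion_eq_zero_of_mem_localPreimage
    (hp2 : p ≠ 2) (hκ : κ.IsCyclotomic) (Cv : VariableChange ℚ) (V : WeierstrassCurve ℚ)
    [V.IsElliptic] [V.IsGloballyMinimal] (hCV : Cv • W.quadraticTwist ((-1) ^ (p / 2) * p) = V)
    (hgood : V.HasGoodReductionAtPrime p) (hap : V.frobeniusTrace p = 0)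
    (hdiv : ∀ P : geomPoints W, ∃ Q : geomPoints W, ((p ^ m : ℕ) : ℤ) • Q = P)
    {ν : ℕ} (hνm : ν ≤ m) (P : W.toAffine.Point) {Q : (W.baseChange ℚ_[p]).toAffine.Point}
    (hPQ : p ^ ν • Q = Affine.Point.baseChange (W' := W) ℚ ℚ_[p] P)
    (hexact : ∀ Q' : (W.baseChange ℚ_[p]).toAffine.Point,
      p ^ (ν + 1) • Q' ≠ Affine.Point.baseChange (W' := W) ℚ ℚ_[p] P)
    (a : ℤ)
    (ha : a • resH1Hom (Literature.NumberTheory.EllipticCurves.subgroupIncl (κ.layerSubgroup 0))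
        (AddMonoidHom.id (geomPrimaryTorsion W p)) (fun _ _ ↦ rfl)
        (galoisCohomology.map (primaryInclusion W p m) 1
          (kummerMapTorsion W ((p ^ m : ℕ) : ℤ) hdiv P)) ∈
        (W.selmerInfty κ ⊓ ⨅ σ : absoluteGaloisGroup ℚ,
            (localKummerOverOfEmb W p κ.kerSubgroup (closureEmb (K := ℚ) ℚ_[p])
              (⨆ n, strictSignedLocalPoints κ ℚ_[p] W (-1) n)).comap
              (W.conjH1 p κ.kerSubgroup σ)).comap (W.layerToInfty κ 0)) :
    p ^ ν • (a • resH1Hom (Literature.NumberTheory.EllipticCurves.subgroupIncl (κ.layerSubgroup 0))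
        (AddMonoidHom.id (geomPrimaryTorsion W p)) (fun _ _ ↦ rfl)
        (galoisCohomology.map (primaryInclusion W p m) 1
          (kummerMapTorsion W ((p ^ m : ℕ) : ℤ) hdiv P))) = 0 := by
  obtain ⟨b, hb⟩ := pow_dvd_of_zsmul_kummerMapTorsion_mem_localPreimage W κ hp2 hκ Cv V hCV hgood hap hdiv
    hνm P hPQ hexact a ha
  set G := galoisCohomology.map (primaryInclusion W p m) 1 with hG
  set Φ := resH1Hom (Literature.NumberTheory.EllipticCurves.subgroupIncl (κ.layerSubgroup 0))
    (AddMonoidHom.id (geomPrimaryTorsion W p)) (fun _ _ ↦ rfl) with hΦ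
  set c : galoisCohomology (W.torsionGaloisModule ((p ^ m : ℕ) : ℤ)) 1 :=
    kummerMapTorsion W ((p ^ m : ℕ) : ℤ) hdiv P with hc
  have hz : ((p ^ ν : ℕ) : ℤ) * a = b * ((p ^ m : ℕ) : ℤ) := by
    rw [hb, ← mul_assoc, mul_comm b]
    congr 1
    push_cast
    rw [← pow_add, Nat.add_sub_cancel' hνm]
  -- `p^m` kills `H¹(ℚ, W[p^m])`, hence `Φ(G(p^m · c)) = 0` (term-mode)
  have hkill : ((p ^ m : ℕ) : ℤ) • Φ (G c) = 0 := by
    have e : Φ (G (((p ^ m : ℕ) : ℤ) • c)) = ((p ^ m : ℕ) : ℤ) • Φ (G c) :=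
      (congrArg Φ (map_zsmul G _ c)).trans (map_zsmul Φ _ (G c))
    have h0 : Φ (G (((p ^ m : ℕ) : ℤ) • c)) = 0 := by
      have hc0 : ((p ^ m : ℕ) : ℤ) • c = 0 := zsmul_galH1Torsion_eq_zero W _ c
      exact ((congrArg (fun z ↦ Φ (G z)) hc0).trans ((congrArg Φ (map_zero G)).trans (map_zero Φ)))
    rw [← e]; exact h0
  rw [← natCast_zsmul, smul_smul, hz, ← smul_smul, hkill]
  exact zsmul_zero b

/-- **In particular `[κ_m(P)] = Φ_m(κ_m(P))` does NOT lie in `A₀` once `m ≥ ν + 1`** (`a = 1`): the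
Kummer classes of the generator beyond the level `ν` are not strict-minus at `p` over the tower.
[cite: Kobayashi2003, Thm. 6.2 (p. 11), §9] [cite: GreenbergLNM1716, §3 pp. 85–90] -/
theorem kummerMapTorsion_not_mem_localPreimage
    (hp2 : p ≠ 2) (hκ : κ.IsCyclotomic) (Cv : VariableChange ℚ) (V : WeierstrassCurve ℚ)
    [V.IsElliptic] [V.IsGloballyMinimal] (hCV : Cv • W.quadraticTwist ((-1) ^ (p / 2) * p) = V)
    (hgood : V.HasGoodReductionAtPrime p) (hap : V.frobeniusTrace p = 0)
    (hdiv : ∀ P : geomPoints W, ∃ Q : geomPoints W, ((p ^ m : ℕ) : ℤ) • Q = P)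
    {ν : ℕ} (hνm : ν + 1 ≤ m) (P : W.toAffine.Point) {Q : (W.baseChange ℚ_[p]).toAffine.Point}
    (hPQ : p ^ ν • Q = Affine.Point.baseChange (W' := W) ℚ ℚ_[p] P)
    (hexact : ∀ Q' : (W.baseChange ℚ_[p]).toAffine.Point,
      p ^ (ν + 1) • Q' ≠ Affine.Point.baseChange (W' := W) ℚ ℚ_[p] P) :
    resH1Hom (Literature.NumberTheory.EllipticCurves.subgroupIncl (κ.layerSubgroup 0))
        (AddMonoidHom.id (geomPrimaryTorsion W p)) (fun _ _ ↦ rfl)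
        (galoisCohomology.map (primaryInclusion W p m) 1
          (kummerMapTorsion W ((p ^ m : ℕ) : ℤ) hdiv P)) ∉
        (W.selmerInfty κ ⊓ ⨅ σ : absoluteGaloisGroup ℚ,
            (localKummerOverOfEmb W p κ.kerSubgroup (closureEmb (K := ℚ) ℚ_[p])
              (⨆ n, strictSignedLocalPoints κ ℚ_[p] W (-1) n)).comap
              (W.conjH1 p κ.kerSubgroup σ)).comap (W.layerToInfty κ 0) := by
  intro hmem
  have h := pow_dvd_of_zsmul_kummerMapTorsion_mem_localPreimage W κ hp2 hκ Cv V hCV hgood hap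
    hdiv (by omega : ν ≤ m) P hPQ hexact 1 (by rwa [one_zsmul])
  have h1 : ((p ^ (m - ν) : ℕ) : ℤ) ∣ 1 := h
  have h2 : p ^ (m - ν) = 1 := by exact_mod_cast Int.eq_one_of_dvd_one (by positivity) h1
  have h3 : m - ν = 0 := (Nat.pow_eq_one.mp h2).resolve_left hp.out.one_lt.ne'
  omega

/-- **The consumers' binders, with the roots of `[p^m]` supplied by the tree** (`hdiv` from
`zsmul_geomPoints_surjective_holds`): `a · Φ_m(κ_m(P)) ∈ A₀ ⟹ p^{m−ν} ∣ a` for `m ≥ ν`, `a ∈ ℤ`.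
[cite: Kobayashi2003, Thm. 6.2 (p. 11), §9] [cite: SilvermanAEC2009, VIII.§2] -/
theorem pow_dvd_of_zsmul_kummerMapTorsion_mem_localPreimage_signedPrime
    (hp2 : p ≠ 2) (hκ : κ.IsCyclotomic) (Cv : VariableChange ℚ) (V : WeierstrassCurve ℚ)
    [V.IsElliptic] [V.IsGloballyMinimal] (hCV : Cv • W.quadraticTwist ((-1) ^ (p / 2) * p) = V)
    (hgood : V.HasGoodReductionAtPrime p) (hap : V.frobeniusTrace p = 0)
    {ν : ℕ} (hνm : ν ≤ m) (P : W.toAffine.Point) {Q : (W.baseChange ℚ_[p]).toAffine.Point}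
    (hPQ : p ^ ν • Q = Affine.Point.baseChange (W' := W) ℚ ℚ_[p] P)
    (hexact : ∀ Q' : (W.baseChange ℚ_[p]).toAffine.Point,
      p ^ (ν + 1) • Q' ≠ Affine.Point.baseChange (W' := W) ℚ ℚ_[p] P)
    (a : ℤ)
    (ha : a • resH1Hom (Literature.NumberTheory.EllipticCurves.subgroupIncl (κ.layerSubgroup 0))
        (AddMonoidHom.id (geomPrimaryTorsion W p)) (fun _ _ ↦ rfl)
        (galoisCohomology.map (primaryInclusion W p m) 1
          (kummerMapTorsion W ((p ^ m : ℕ) : ℤ)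
            (W.zsmul_geomPoints_surjective_holds
              (show (((p ^ m : ℕ) : ℤ)) ≠ 0 by exact_mod_cast pow_ne_zero m hp.out.ne_zero)) P)) ∈
        (W.selmerInfty κ ⊓ ⨅ σ : absoluteGaloisGroup ℚ,
            (localKummerOverOfEmb W p κ.kerSubgroup (closureEmb (K := ℚ) ℚ_[p])
              (⨆ n, strictSignedLocalPoints κ ℚ_[p] W (-1) n)).comap
              (W.conjH1 p κ.kerSubgroup σ)).comap (W.layerToInfty κ 0)) :
    ((p ^ (m - ν) : ℕ) : ℤ) ∣ a :=
  pow_dvd_of_zsmul_kummerMapTorsion_mem_localPreimage W κ hp2 hκ Cv V hCV hgood hap _ hνm P hPQ hexact a ha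

end Twist

end Summit.BirchSwinnertonDyer.Rank1Residual.Additive.LevelBridge

end
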